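import Mathlib
import Literature.NumberTheory.Automorphic.HilbertModularFormQExpansion

/-!
# Squares of congruence units have finite index in the unit group

Stub M-A5 (`stub_unitCongruence_sq_finiteIndex`) of line Sketch-ideate-r1-k1 of the crux
`HilbertIntegralOverconvergentIsCongruence` (stmt-Langlands-8485), used in the Koecher principle
(Freitag, *Hilbert Modular Forms*, Ch. I Cor. 4.9): for a non-zero ideal `𝔪` of the ring of integers
`𝓞 K` of a number field, the unit group `(𝓞 K)ˣ` has a finite-index subgroup consisting of squares
`ε ^ 2` of units `ε ≡ 1 (mod 𝔪)`.

Proof: the congruence units `U₁ = {ε | ε ≡ 1 mod 𝔪}` are the kernel of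
`(𝓞 K)ˣ → (𝓞 K ⧸ 𝔪)ˣ`, whose target is finite (`Ideal.finiteQuotientOfFreeOfNeBot`), so `U₁` has
finite index; `(𝓞 K)ˣ` is finitely generated (Dirichlet, Mathlib `Monoid.FG (𝓞 K)ˣ`), hence so is
`U₁` (Schreier), and the squares of a finitely generated commutative group have finite index in it
(`Subgroup.isFiniteRelIndex_map_powMonoidHom_of_fg`).  We take `U = U₁.map (powMonoidHom 2)`;
no auxiliary definitions are introduced.
-/

set_option linter.dupNamespace false

noncomputable section

namespace Summit.Langlands.Langlands.Theorems.HilbertIntegralOverconvergentIsCongruence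

open NumberField

/-- A unit lies in the kernel of the reduction map `(𝓞 K)ˣ → (𝓞 K ⧸ 𝔪)ˣ` iff it is
`≡ 1 (mod 𝔪)`. -/
theorem ucs_mem_ker_unitsMap_iff (K : Type) [Field K] [NumberField K] (𝔪 : Ideal (𝓞 K))
    (ε : (𝓞 K)ˣ) :
    ε ∈ (Units.map (Ideal.Quotient.mk 𝔪 : 𝓞 K →+* 𝓞 K ⧸ 𝔪).toMonoidHom).ker ↔
      (ε : 𝓞 K) - 1 ∈ 𝔪 := by
  rw [MonoidHom.mem_ker, Units.ext_iff, Units.coe_map, RingHom.toMonoidHom_eq_coe,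
    MonoidHom.coe_coe, Units.val_one, ← map_one (Ideal.Quotient.mk 𝔪), Ideal.Quotient.eq]

/-- The congruence units `≡ 1 (mod 𝔪)` (the kernel of `(𝓞 K)ˣ → (𝓞 K ⧸ 𝔪)ˣ`) have finite index
in `(𝓞 K)ˣ` for `𝔪 ≠ ⊥`, the target being finite. -/
theorem ucs_ker_unitsMap_finiteIndex (K : Type) [Field K] [NumberField K] (𝔪 : Ideal (𝓞 K))
    (h𝔪 : 𝔪 ≠ ⊥) :
    (Units.map (Ideal.Quotient.mk 𝔪 : 𝓞 K →+* 𝓞 K ⧸ 𝔪).toMonoidHom).ker.FiniteIndex := by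
  haveI : Finite (𝓞 K ⧸ 𝔪) := Ideal.finiteQuotientOfFreeOfNeBot 𝔪 h𝔪
  infer_instance

/-- In a finitely generated commutative group, the squares of a finite-index subgroup form a
finite-index subgroup (Schreier: the subgroup is finitely generated; a finitely generated
commutative group modulo its squares is finite). -/
theorem ucs_map_powMonoidHom_two_finiteIndex {G : Type*} [CommGroup G] [Group.FG G]
    (H : Subgroup G) [hH : H.FiniteIndex] : (H.map (powMonoidHom 2)).FiniteIndex := by
  haveI : Group.FG H := Subgroup.fg_of_index_ne_zero H
  have hfg : H.FG := (Group.fg_iff_subgroup_fg H).mp inferInstance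
  have hrel : (H.map (powMonoidHom 2)).IsFiniteRelIndex H :=
    Subgroup.isFiniteRelIndex_map_powMonoidHom_of_fg hfg two_ne_zero
  have hle : H.map (powMonoidHom 2) ≤ H := by
    rintro _ ⟨ε, hε, rfl⟩
    exact H.pow_mem hε 2
  refine ⟨?_⟩
  rw [← Subgroup.relIndex_mul_index hle]
  exact mul_ne_zero hrel.relIndex_ne_zero hH.index_ne_zero

/-- **stub M-A5 — `stub_unitCongruence_sq_finiteIndex`.** For a non-zero ideal `𝔪` of a number ring,
the squares of the units `≡ 1 (mod 𝔪)` contain a finite-index subgroup of the unit group (the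
congruence units are the kernel of `(𝓞 K)ˣ → (𝓞 K ⧸ 𝔪)ˣ`, finite target; the unit group is finitely
generated, Dirichlet, so squares have finite index). [folklore] -/
theorem stub_unitCongruence_sq_finiteIndex (K : Type) [Field K] [NumberField K] (𝔪 : Ideal (𝓞 K))
    (h𝔪 : 𝔪 ≠ ⊥) :
    ∃ U : Subgroup (𝓞 K)ˣ, U.FiniteIndex ∧ ∀ η ∈ U, ∃ ε : (𝓞 K)ˣ, (ε : 𝓞 K) - 1 ∈ 𝔪 ∧ η = ε ^ 2 := by
  haveI := ucs_ker_unitsMap_finiteIndex K 𝔪 h𝔪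
  haveI : Group.FG (𝓞 K)ˣ := Group.fg_iff_monoid_fg.mpr inferInstance
  refine ⟨(Units.map (Ideal.Quotient.mk 𝔪 : 𝓞 K →+* 𝓞 K ⧸ 𝔪).toMonoidHom).ker.map
    (powMonoidHom 2), ucs_map_powMonoidHom_two_finiteIndex _, ?_⟩
  rintro η ⟨ε, hε, rfl⟩
  exact ⟨ε, (ucs_mem_ker_unitsMap_iff K 𝔪 ε).mp hε, rfl⟩

end Summit.Langlands.Langlands.Theorems.HilbertIntegralOverconvergentIsCongruence
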